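import Summits.Ventures.Crystal3D.StickySpheres.SmallContactInduction
import HarnessLib

/-!
# Finite contact numbers from a non-realisability sweep: the exposed-triangle-free induction

Venture `Crystal3D` (cell `pub-crystal3d`, seat p2), continuation of `StickySpheres/SmallContactInduction.lean`.

HONEST FRAMING. `SmallContactInduction.lean` formalised Bezdek–Khan's Prop. 5.1 with its original hypothesis (every
packing in the stratum has exactly `3n − 6` contacts AND an exposed triangle). This file records a SIMPLER route to the
same conclusion that needs NO exposed-triangle information about arbitrary (possibly flexible) packings: if the target
values `t n` grow by at least `3` per ball, are attained (one witness packing per `n`), and no packing with all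
coordinations `≥ 3` exceeds `t n` (this is the census statement: every graph on `n` vertices with minimum degree `≥ 3`
and MORE than `t n` edges is not a contact graph), then `C(n) = t n` — because a ball with `≤ 2` contacts in a maximiser
would give `C(n) ≤ 2 + C(n−1) = 2 + t(n−1) < t n ≤ C(n)`. The census inputs remain hypotheses; nothing enumerative is
proved here, and nothing about crystallization.
-/

noncomputable section

open Finset
open scoped BigOperators

namespace Summit.Ventures.Crystal3D

/-- **The stratum hypothesis `S(t, n)`**: no unit packing of `n` balls in `ℝ³` whose balls all have at least three
contacts has more than `t` contacts (equivalently: no graph on `n` vertices with minimum degree `≥ 3` and `> t` edges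
is the contact graph of a packing — what an exact non-realisability sweep certifies). [folklore] -/
def StratumHypothesis (t n : ℕ) : Prop :=
  ∀ x : Fin n → EuclideanSpace ℝ (Fin 3), IsUnitPacking x → (∀ i, 3 ≤ coordination x i) → numContacts x ≤ t

/-- **Maximisers have minimum coordination three** as soon as `C(n) ≥ C(n−1) + 3`: a ball with at most two contacts
could be removed at a loss of `≤ 2`. [folklore] -/
theorem three_le_coordination_of_maximal {m : ℕ} {x : Fin (m + 1) → EuclideanSpace ℝ (Fin 3)}
    (hx : IsUnitPacking x) (hxe : numContacts x = maxContacts 3 (m + 1))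
    (hgrow : maxContacts 3 m + 3 ≤ maxContacts 3 (m + 1)) (i : Fin (m + 1)) : 3 ≤ coordination x i := by
  by_contra h
  push Not at h
  have h1 : numContacts x ≤ 2 + maxContacts 3 m := numContacts_le_add_maxContacts hx (by omega : coordination x i ≤ 2)
  omega

/-- **Contact numbers from the stratum sweep.** Let `t : ℕ → ℕ` and `n₁ ≤ n₂`. If `C(n₁) = t n₁`, and for every
`n₁ < n ≤ n₂`: `t (n−1) + 3 ≤ t n`, `t n ≤ C(n)` (a witness), and `S(t n, n)` (the sweep), then `C(n) = t n` for all
`n₁ ≤ n ≤ n₂`, and for `n > n₁` every maximiser has all coordinations `≥ 3`. [folklore] -/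
theorem maxContacts_eq_of_stratum (t : ℕ → ℕ) {n₁ n₂ : ℕ} (hbase : maxContacts 3 n₁ = t n₁)
    (hstep : ∀ n, n₁ < n → n ≤ n₂ → t (n - 1) + 3 ≤ t n)
    (hwit : ∀ n, n₁ < n → n ≤ n₂ → t n ≤ maxContacts 3 n)
    (hS : ∀ n, n₁ < n → n ≤ n₂ → StratumHypothesis (t n) n) :
    ∀ n, n₁ ≤ n → n ≤ n₂ → maxContacts 3 n = t n ∧
      (n₁ < n → ∀ x : Fin n → EuclideanSpace ℝ (Fin 3), IsUnitPacking x → numContacts x = maxContacts 3 n →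
        ∀ i, 3 ≤ coordination x i) := by
  intro n hn1 hn2
  induction n using Nat.strong_induction_on with
  | _ n ih =>
    rcases eq_or_lt_of_le hn1 with rfl | hlt
    · exact ⟨hbase, fun h => absurd h (lt_irrefl _)⟩
    · obtain ⟨m, rfl⟩ : ∃ m, n = m + 1 := ⟨n - 1, by omega⟩
      have ihC : maxContacts 3 m = t m := (ih m (by omega) (by omega) (by omega)).1
      have hst := hstep (m + 1) hlt hn2
      simp only [Nat.add_sub_cancel] at hst
      have hw := hwit (m + 1) hlt hn2
      have hgrow : maxContacts 3 m + 3 ≤ maxContacts 3 (m + 1) := by omega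
      have hmin : ∀ x : Fin (m + 1) → EuclideanSpace ℝ (Fin 3), IsUnitPacking x →
          numContacts x = maxContacts 3 (m + 1) → ∀ i, 3 ≤ coordination x i :=
        fun x hx hxe => three_le_coordination_of_maximal hx hxe hgrow
      obtain ⟨x, hx, hxe⟩ := exists_numContacts_eq_maxContacts (by norm_num : 0 < 3) (m + 1)
      have hle : numContacts x ≤ t (m + 1) := hS (m + 1) hlt hn2 x hx (hmin x hx hxe)
      exact ⟨by omega, fun _ => hmin⟩

/-- **Specialisation `t n = 3n − 6` from `n₁ = 4`** (`C(4) = 6` is proved in `StickySpheres/SmallContactBase.lean`; here it is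
an argument so that this file does not depend on it): given witnesses `3n − 6 ≤ C(n)` and the sweeps `S(3n−6, n)` for
`5 ≤ n ≤ n₂`, `C(n) = 3n − 6` for `4 ≤ n ≤ n₂`. For `n₂ = 9` this is the theorem "C(n) = 3n − 6, n ≤ 9" of
Arkus–Manoharan–Brenner / Bezdek–Khan Prop. 5.1, conditional exactly on the certified census. [folklore] -/
theorem maxContacts_eq_three_mul_sub_six {n₂ : ℕ} (h4 : maxContacts 3 4 = 6)
    (hwit : ∀ n, 4 < n → n ≤ n₂ → 3 * n - 6 ≤ maxContacts 3 n)
    (hS : ∀ n, 4 < n → n ≤ n₂ → StratumHypothesis (3 * n - 6) n) :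
    ∀ n, 4 ≤ n → n ≤ n₂ → maxContacts 3 n = 3 * n - 6 :=
  fun n hn1 hn2 => (maxContacts_eq_of_stratum (fun n => 3 * n - 6) (n₁ := 4) h4
    (fun n hn _ => by omega) hwit hS n hn1 hn2).1

/-- **Witnesses from docking** (so that `hwit` can be produced from ONE certified cluster per size, or propagated): if
some maximiser of `m` balls has an exposed triangle then `C(m) + 3 ≤ C(m+1)`. [folklore] -/
theorem maxContacts_add_three_le {m : ℕ} {x : Fin m → EuclideanSpace ℝ (Fin 3)} (hx : IsUnitPacking x)
    (hxe : numContacts x = maxContacts 3 m) (hT : HasExposedTriangle x) : maxContacts 3 m + 3 ≤ maxContacts 3 (m + 1) := by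
  have := numContacts_add_three_le_maxContacts hx hT
  rw [hxe] at this
  exact this

end Summit.Ventures.Crystal3D

end
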